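import Summits.ValiantsHypothesis.ValiantsHypothesis.Theorems.NewtonFramesTwoProductsFrameRungTwoGenericBlocks
import Summits.ValiantsHypothesis.ValiantsHypothesis.Theorems.NewtonFramesTwoProductsFrameRungTwoShallowNeighbour

/-!
# Crux `TwoProducts` (stmt-5906), line `FrameRungTwo`: the shallow-neighbour lemma (IX) REDUCED TO TWO POLYNOMIAL-FREE KERNELS

`hIX` / `hIX'` of `crossCancel_of_shallowNeighbour` (`…FrameRungTwoShallowNeighbour.lean`, p603280) quantify over polynomials,
coefficients, a functional and a non-cancelled vertex.  This file isolates, by name, the two finitary statements that imply them: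

* the OUT kernel (hypothesis `hOut` below): two DISSOCIATED families of finite letter sets `S, S' : Fin m → Finset (Fin 2 →₀ ℕ)` with
  key-tops `T, T'` of equal sum, a deep word `a` of `S` (≥ 4 letters below the tops) with sum `e` key-below the top, such that every
  word sum of either family that is `l`-light (`l e ≤ l x`, `x ≠ e`) is a word sum of the other family (the WINDOW property), and `e`
  is NOT a word sum of `S'`; conclusion: the neighbour certificate of (IX).  In gap language this is exactly the window-factorization
  statement (W) of `Cruxes/TwoProducts/memo-IX-windows.md` §0 — no coefficients, no polynomials;
* the BOTH kernel (hypothesis `hBoth`): the same data, but `e` IS a word sum of `S'`, by a word `u` demoting ≥ 4 letters, and letter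
  weights `cf, cg` (nonzero on the letters) cancel at every light common point other than `e` but NOT at `e`; conclusion: the same
  certificate.  (Conjecture Q4′ of `memo-IX-robust.md` §2 says the hypotheses of the BOTH kernel are contradictory — deep–deep common
  tops always cancel — which would discharge it vacuously; a word `u` demoting ≤ 3 letters needs no kernel: `neighbour_of_shallow_gword`.)

`shallowNeighbour_of_cores`: OUT kernel ∧ BOTH kernel ⇒ `hIX` verbatim (for `f, g`; applied to `g, f` it gives `hIX'`), hence
`crossCancel_of_cores`: the `k = 2` cross-cancelling count `≤ (m t + 2)^8` for all pairs of dissociated frames from the two kernels.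
So after this file the open per-vertex content of the `k = 2` layer is literally the pair (`hOut`, `hBoth`) — finite sets of lattice
points, a functional, and (for `hBoth`) letter weights; the disprovers' 1-D window model is `hOut` read through `l`.
Honest scope: a REDUCTION for ONE stub of a rung strictly below the crux `TwoProducts`; neither kernel is proved here; nothing here
bears on `VP ≠ VNP`.  [ours; setting KPTT arXiv:1308.2286 §2, §5]
-/

set_option linter.dupNamespace false

namespace Summit.ValiantsHypothesis.ValiantsHypothesis.Theorems.NewtonFramesTwoProducts.FrameRungTwoTrinomial

open MvPolynomial
open scoped BigOperators Classical
open Summit.ValiantsHypothesis.Theorems.DissociatedFixedK (lexKey lexKey_injective)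
open Summit.ValiantsHypothesis.ValiantsHypothesis.Theorems.DissociatedFixedK.Negative (emb emb_injective)
open Summit.ValiantsHypothesis.ValiantsHypothesis.Theorems.NewtonFramesTwoProducts.FrameRungTwoBinomial
  (emb_add emb_sum apply_le_of_lexKey_le coeff_word exists_word prod_coeff_ne_zero cross_empty_of_union_subset)

noncomputable section

section Core

variable {m : ℕ}

/-- A word of the non-member family whose sum is key-below the common top demotes at least one letter of the top tuple.
[folklore] -/
theorem filter_nonempty_of_sum_lt (lc : (Fin 2 → ℝ) →L[ℝ] ℝ) (T T' u : Fin m → (Fin 2 →₀ ℕ)) (e : Fin 2 →₀ ℕ)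
    (hue : ∑ j, u j = e) (htop : ∑ j, T j = ∑ j, T' j) (hTe : lexKey lc e < lexKey lc (∑ j, T j)) :
    (Finset.univ.filter fun i => u i ≠ T' i).Nonempty := by
  by_contra h
  rw [Finset.not_nonempty_iff_eq_empty, Finset.filter_eq_empty_iff] at h
  have hu : u = T' := funext fun i => by
    have := h (Finset.mem_univ i); push Not at this; exact this
  rw [hu, ← htop] at hue
  rw [hue] at hTe
  exact lt_irrefl _ hTe

/-- **A shallow word of the other family is its own certificate.**  If `e = Σ u` for a word `u` of `S'` demoting at most three
letters of `T'` (and at least one), then un-demoting one demoted letter `j₀` gives the neighbour form of (IX):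
`e = Σ w − (T' j₀ − u j₀)` with `w = u[j₀ ↦ T' j₀]` demoting ≤ 2 letters. [ours] -/
theorem neighbour_of_shallow_gword (S' : Fin m → Finset (Fin 2 →₀ ℕ)) (T' u : Fin m → (Fin 2 →₀ ℕ)) (e : Fin 2 →₀ ℕ)
    (hT' : ∀ j, T' j ∈ S' j) (hu : ∀ j, u j ∈ S' j) (hue : ∑ j, u j = e)
    (hne : (Finset.univ.filter fun i => u i ≠ T' i).Nonempty)
    (h3 : (Finset.univ.filter fun i => u i ≠ T' i).card ≤ 3) :
    ∃ (w : Fin m → (Fin 2 →₀ ℕ)) (p : Fin m) (y : Fin 2 →₀ ℕ), (∀ i, w i ∈ S' i) ∧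
      (Finset.univ.filter fun i => w i ≠ T' i).card ≤ 2 ∧ y ∈ S' p ∧
      emb e = emb (∑ i, w i) - (emb (T' p) - emb y) := by
  obtain ⟨j₀, hj₀⟩ := hne
  refine ⟨Function.update u j₀ (T' j₀), j₀, u j₀, ?_, ?_, hu j₀, ?_⟩
  · intro i
    rcases eq_or_ne i j₀ with rfl | hne
    · rw [Function.update_self]; exact hT' i
    · rw [Function.update_of_ne hne]; exact hu i
  · have hsub : (Finset.univ.filter fun i => Function.update u j₀ (T' j₀) i ≠ T' i) =
        (Finset.univ.filter fun i => u i ≠ T' i).erase j₀ := by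
      ext i
      simp only [Finset.mem_filter, Finset.mem_univ, true_and, Finset.mem_erase]
      rcases eq_or_ne i j₀ with rfl | hne
      · simp
      · rw [Function.update_of_ne hne]; exact ⟨fun h => ⟨hne, h⟩, fun h => h.2⟩
    rw [hsub, Finset.card_erase_of_mem hj₀]
    omega
  · rw [emb_sum_update u j₀ (T' j₀), hue]
    abel

/-- **(IX) from the two polynomial-free kernels.**  For dissociated `f`, `g`, the hypothesis `hIX` of
`crossCancel_of_shallowNeighbour` (p603280) — stated here VERBATIM as the conclusion — follows from the OUT kernel `hOut` and the BOTH
kernel `hBoth` (module docstring).  Proof: the window property is `common_fword_of_gword` in both directions; if `e` has no `g`-word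
apply `hOut` to the supports; if it has a `g`-word demoting ≤ 3 letters use `neighbour_of_shallow_gword`; otherwise apply `hBoth` with
the letter coefficients as weights (`coeff_word`). [ours] -/
theorem shallowNeighbour_of_cores (f g : Fin m → MvPolynomial (Fin 2) ℂ)
    (hinjf : ∀ a b : Fin m → (Fin 2 →₀ ℕ), (∀ j, a j ∈ (f j).support) → (∀ j, b j ∈ (f j).support) →
      ∑ j, a j = ∑ j, b j → a = b)
    (hinjg : ∀ a b : Fin m → (Fin 2 →₀ ℕ), (∀ j, a j ∈ (g j).support) → (∀ j, b j ∈ (g j).support) →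
      ∑ j, a j = ∑ j, b j → a = b)
    (hOut : ∀ (S S' : Fin m → Finset (Fin 2 →₀ ℕ)) (lc : (Fin 2 → ℝ) →L[ℝ] ℝ) (e : Fin 2 →₀ ℕ)
        (T T' a : Fin m → (Fin 2 →₀ ℕ)),
      (∀ b c : Fin m → (Fin 2 →₀ ℕ), (∀ j, b j ∈ S j) → (∀ j, c j ∈ S j) → ∑ j, b j = ∑ j, c j → b = c) →
      (∀ b c : Fin m → (Fin 2 →₀ ℕ), (∀ j, b j ∈ S' j) → (∀ j, c j ∈ S' j) → ∑ j, b j = ∑ j, c j → b = c) →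
      (∀ j, T j ∈ S j) → (∀ j, ∀ x ∈ S j, lexKey lc x ≤ lexKey lc (T j)) →
      (∀ j, T' j ∈ S' j) → (∀ j, ∀ x ∈ S' j, lexKey lc x ≤ lexKey lc (T' j)) →
      (∀ j, a j ∈ S j) → ∑ j, a j = e → ∑ j, T j = ∑ j, T' j → lexKey lc e < lexKey lc (∑ j, T j) →
      (∀ b : Fin m → (Fin 2 →₀ ℕ), (∀ j, b j ∈ S j) → ∑ j, b j ≠ e → lc (emb e) ≤ lc (emb (∑ j, b j)) →
        ∃ c : Fin m → (Fin 2 →₀ ℕ), (∀ j, c j ∈ S' j) ∧ ∑ j, c j = ∑ j, b j) →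
      (∀ c : Fin m → (Fin 2 →₀ ℕ), (∀ j, c j ∈ S' j) → ∑ j, c j ≠ e → lc (emb e) ≤ lc (emb (∑ j, c j)) →
        ∃ b : Fin m → (Fin 2 →₀ ℕ), (∀ j, b j ∈ S j) ∧ ∑ j, b j = ∑ j, c j) →
      (∀ c : Fin m → (Fin 2 →₀ ℕ), (∀ j, c j ∈ S' j) → ∑ j, c j ≠ e) →
      4 ≤ (Finset.univ.filter fun i => a i ≠ T i).card →
      ∃ (w : Fin m → (Fin 2 →₀ ℕ)) (p : Fin m) (y : Fin 2 →₀ ℕ), (∀ i, w i ∈ S' i) ∧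
        (Finset.univ.filter fun i => w i ≠ T' i).card ≤ 2 ∧ y ∈ S' p ∧
        emb e = emb (∑ i, w i) - (emb (T' p) - emb y))
    (hBoth : ∀ (S S' : Fin m → Finset (Fin 2 →₀ ℕ)) (lc : (Fin 2 → ℝ) →L[ℝ] ℝ) (e : Fin 2 →₀ ℕ)
        (T T' a u : Fin m → (Fin 2 →₀ ℕ)) (cf cg : Fin m → (Fin 2 →₀ ℕ) → ℂ),
      (∀ b c : Fin m → (Fin 2 →₀ ℕ), (∀ j, b j ∈ S j) → (∀ j, c j ∈ S j) → ∑ j, b j = ∑ j, c j → b = c) →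
      (∀ b c : Fin m → (Fin 2 →₀ ℕ), (∀ j, b j ∈ S' j) → (∀ j, c j ∈ S' j) → ∑ j, b j = ∑ j, c j → b = c) →
      (∀ j, T j ∈ S j) → (∀ j, ∀ x ∈ S j, lexKey lc x ≤ lexKey lc (T j)) →
      (∀ j, T' j ∈ S' j) → (∀ j, ∀ x ∈ S' j, lexKey lc x ≤ lexKey lc (T' j)) →
      (∀ j, a j ∈ S j) → ∑ j, a j = e → (∀ j, u j ∈ S' j) → ∑ j, u j = e →
      ∑ j, T j = ∑ j, T' j → lexKey lc e < lexKey lc (∑ j, T j) →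
      (∀ b : Fin m → (Fin 2 →₀ ℕ), (∀ j, b j ∈ S j) → ∑ j, b j ≠ e → lc (emb e) ≤ lc (emb (∑ j, b j)) →
        ∃ c : Fin m → (Fin 2 →₀ ℕ), (∀ j, c j ∈ S' j) ∧ ∑ j, c j = ∑ j, b j) →
      (∀ c : Fin m → (Fin 2 →₀ ℕ), (∀ j, c j ∈ S' j) → ∑ j, c j ≠ e → lc (emb e) ≤ lc (emb (∑ j, c j)) →
        ∃ b : Fin m → (Fin 2 →₀ ℕ), (∀ j, b j ∈ S j) ∧ ∑ j, b j = ∑ j, c j) →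
      4 ≤ (Finset.univ.filter fun i => a i ≠ T i).card → 4 ≤ (Finset.univ.filter fun i => u i ≠ T' i).card →
      (∀ j, ∀ x ∈ S j, cf j x ≠ 0) → (∀ j, ∀ x ∈ S' j, cg j x ≠ 0) →
      (∀ b c : Fin m → (Fin 2 →₀ ℕ), (∀ j, b j ∈ S j) → (∀ j, c j ∈ S' j) → ∑ j, b j = ∑ j, c j →
        ∑ j, b j ≠ e → lc (emb e) ≤ lc (emb (∑ j, b j)) → ∏ j, cf j (b j) + ∏ j, cg j (c j) = 0) →
      ∏ j, cf j (a j) + ∏ j, cg j (u j) ≠ 0 →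
      ∃ (w : Fin m → (Fin 2 →₀ ℕ)) (p : Fin m) (y : Fin 2 →₀ ℕ), (∀ i, w i ∈ S' i) ∧
        (Finset.univ.filter fun i => w i ≠ T' i).card ≤ 2 ∧ y ∈ S' p ∧
        emb e = emb (∑ i, w i) - (emb (T' p) - emb y)) :
    ∀ (lc : (Fin 2 → ℝ) →L[ℝ] ℝ) (e : Fin 2 →₀ ℕ) (T T' a : Fin m → (Fin 2 →₀ ℕ)),
      (∀ j, T j ∈ (f j).support) → (∀ j, ∀ x ∈ (f j).support, lexKey lc x ≤ lexKey lc (T j)) →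
      (∀ j, T' j ∈ (g j).support) → (∀ j, ∀ x ∈ (g j).support, lexKey lc x ≤ lexKey lc (T' j)) →
      (∀ j, a j ∈ (f j).support) → ∑ j, a j = e →
      (∀ x : Fin 2 →₀ ℕ, x ≠ e → lc (emb e) ≤ lc (emb x) → coeff x (∏ j, f j) + coeff x (∏ j, g j) = 0) →
      coeff e (∏ j, f j) + coeff e (∏ j, g j) ≠ 0 → ∑ j, T j = ∑ j, T' j → lexKey lc e < lexKey lc (∑ j, T j) →
      (Finset.univ.filter fun i => a i ≠ T i).card ≤ 3 ∨
        ∃ (w : Fin m → (Fin 2 →₀ ℕ)) (p : Fin m) (y : Fin 2 →₀ ℕ), (∀ i, w i ∈ (g i).support) ∧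
          (Finset.univ.filter fun i => w i ≠ T' i).card ≤ 2 ∧ y ∈ (g p).support ∧
          emb e = emb (∑ i, w i) - (emb (T' p) - emb y) := by
  intro lc e T T' a hT hTmax hT' hTmax' ha hae hzero he htop hTe
  by_cases h3 : (Finset.univ.filter fun i => a i ≠ T i).card ≤ 3
  · exact Or.inl h3
  right
  have h4 : 4 ≤ (Finset.univ.filter fun i => a i ≠ T i).card := by omega
  have hzero' : ∀ x : Fin 2 →₀ ℕ, x ≠ e → lc (emb e) ≤ lc (emb x) →
      coeff x (∏ j, g j) + coeff x (∏ j, f j) = 0 := fun x hx hle => by rw [add_comm]; exact hzero x hx hle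
  -- the window property, both directions
  have hwinf : ∀ b : Fin m → (Fin 2 →₀ ℕ), (∀ j, b j ∈ (f j).support) → ∑ j, b j ≠ e →
      lc (emb e) ≤ lc (emb (∑ j, b j)) →
      ∃ c : Fin m → (Fin 2 →₀ ℕ), (∀ j, c j ∈ (g j).support) ∧ ∑ j, c j = ∑ j, b j :=
    fun b hb hbe hle => common_fword_of_gword lc g f hinjg hinjf e hzero' hb hle hbe
  have hwing : ∀ c : Fin m → (Fin 2 →₀ ℕ), (∀ j, c j ∈ (g j).support) → ∑ j, c j ≠ e →
      lc (emb e) ≤ lc (emb (∑ j, c j)) →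
      ∃ b : Fin m → (Fin 2 →₀ ℕ), (∀ j, b j ∈ (f j).support) ∧ ∑ j, b j = ∑ j, c j :=
    fun c hc hce hle => common_fword_of_gword lc f g hinjf hinjg e hzero hc hle hce
  by_cases hex : ∃ u : Fin m → (Fin 2 →₀ ℕ), (∀ j, u j ∈ (g j).support) ∧ ∑ j, u j = e
  · obtain ⟨u, hu, hue⟩ := hex
    have hune : (Finset.univ.filter fun i => u i ≠ T' i).Nonempty :=
      filter_nonempty_of_sum_lt lc T T' u e hue htop hTe
    by_cases hu3 : (Finset.univ.filter fun i => u i ≠ T' i).card ≤ 3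
    · exact neighbour_of_shallow_gword (fun i => (g i).support) T' u e hT' hu hue hune hu3
    · have hu4 : 4 ≤ (Finset.univ.filter fun i => u i ≠ T' i).card := by omega
      -- letter coefficients as weights
      have hcancel : ∀ b c : Fin m → (Fin 2 →₀ ℕ), (∀ j, b j ∈ (f j).support) → (∀ j, c j ∈ (g j).support) →
          ∑ j, b j = ∑ j, c j → ∑ j, b j ≠ e → lc (emb e) ≤ lc (emb (∑ j, b j)) →
          ∏ j, coeff (b j) (f j) + ∏ j, coeff (c j) (g j) = 0 := by
        intro b c hb hc hbc hbe hle
        have h := hzero _ hbe hle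
        rwa [coeff_word f hinjf b hb, hbc, coeff_word g hinjg c hc] at h
      have hee : ∏ j, coeff (a j) (f j) + ∏ j, coeff (u j) (g j) ≠ 0 := by
        have h1 : coeff e (∏ j, f j) = ∏ j, coeff (a j) (f j) := by rw [← hae]; exact coeff_word f hinjf a ha
        have h2 : coeff e (∏ j, g j) = ∏ j, coeff (u j) (g j) := by rw [← hue]; exact coeff_word g hinjg u hu
        rw [h1, h2] at he
        exact he
      exact hBoth (fun j => (f j).support) (fun j => (g j).support) lc e T T' a u
        (fun j x => coeff x (f j)) (fun j x => coeff x (g j)) hinjf hinjg hT hTmax hT' hTmax' ha hae hu hue htop hTe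
        hwinf hwing h4 hu4 (fun j x hx => mem_support_iff.1 hx) (fun j x hx => mem_support_iff.1 hx) hcancel hee
  · push Not at hex
    exact hOut (fun j => (f j).support) (fun j => (g j).support) lc e T T' a hinjf hinjg hT hTmax hT' hTmax' ha hae
      htop hTe hwinf hwing (fun c hc => hex c hc) h4

/-- **The `k = 2` cross-cancelling count from the two kernels.**  For every pair of dissociated frames (any `t`, carries allowed)
the cross-cancelling vertices of `Π f + Π g` number `≤ (m t + 2)^8`, GIVEN the OUT kernel and the BOTH kernel of
`shallowNeighbour_of_cores` (they serve both orientations `hIX`, `hIX'` of `crossCancel_of_shallowNeighbour`, p603280). [ours] -/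
theorem crossCancel_of_cores (m t : ℕ) (A B : Fin m → Finset (Fin 2 →₀ ℕ))
    (f g : Fin m → MvPolynomial (Fin 2) ℂ)
    (hA : ∀ j, (A j).card ≤ t) (hB : ∀ j, (B j).card ≤ t)
    (hf : ∀ j, (f j).support ⊆ A j) (hg : ∀ j, (g j).support ⊆ B j)
    (hinjA : ∀ a b : Fin m → (Fin 2 →₀ ℕ), (∀ j, a j ∈ A j) → (∀ j, b j ∈ A j) → ∑ j, a j = ∑ j, b j → a = b)
    (hinjB : ∀ a b : Fin m → (Fin 2 →₀ ℕ), (∀ j, a j ∈ B j) → (∀ j, b j ∈ B j) → ∑ j, a j = ∑ j, b j → a = b)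
    (hOut : ∀ (S S' : Fin m → Finset (Fin 2 →₀ ℕ)) (lc : (Fin 2 → ℝ) →L[ℝ] ℝ) (e : Fin 2 →₀ ℕ)
        (T T' a : Fin m → (Fin 2 →₀ ℕ)),
      (∀ b c : Fin m → (Fin 2 →₀ ℕ), (∀ j, b j ∈ S j) → (∀ j, c j ∈ S j) → ∑ j, b j = ∑ j, c j → b = c) →
      (∀ b c : Fin m → (Fin 2 →₀ ℕ), (∀ j, b j ∈ S' j) → (∀ j, c j ∈ S' j) → ∑ j, b j = ∑ j, c j → b = c) →
      (∀ j, T j ∈ S j) → (∀ j, ∀ x ∈ S j, lexKey lc x ≤ lexKey lc (T j)) →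
      (∀ j, T' j ∈ S' j) → (∀ j, ∀ x ∈ S' j, lexKey lc x ≤ lexKey lc (T' j)) →
      (∀ j, a j ∈ S j) → ∑ j, a j = e → ∑ j, T j = ∑ j, T' j → lexKey lc e < lexKey lc (∑ j, T j) →
      (∀ b : Fin m → (Fin 2 →₀ ℕ), (∀ j, b j ∈ S j) → ∑ j, b j ≠ e → lc (emb e) ≤ lc (emb (∑ j, b j)) →
        ∃ c : Fin m → (Fin 2 →₀ ℕ), (∀ j, c j ∈ S' j) ∧ ∑ j, c j = ∑ j, b j) →
      (∀ c : Fin m → (Fin 2 →₀ ℕ), (∀ j, c j ∈ S' j) → ∑ j, c j ≠ e → lc (emb e) ≤ lc (emb (∑ j, c j)) →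
        ∃ b : Fin m → (Fin 2 →₀ ℕ), (∀ j, b j ∈ S j) ∧ ∑ j, b j = ∑ j, c j) →
      (∀ c : Fin m → (Fin 2 →₀ ℕ), (∀ j, c j ∈ S' j) → ∑ j, c j ≠ e) →
      4 ≤ (Finset.univ.filter fun i => a i ≠ T i).card →
      ∃ (w : Fin m → (Fin 2 →₀ ℕ)) (p : Fin m) (y : Fin 2 →₀ ℕ), (∀ i, w i ∈ S' i) ∧
        (Finset.univ.filter fun i => w i ≠ T' i).card ≤ 2 ∧ y ∈ S' p ∧
        emb e = emb (∑ i, w i) - (emb (T' p) - emb y))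
    (hBoth : ∀ (S S' : Fin m → Finset (Fin 2 →₀ ℕ)) (lc : (Fin 2 → ℝ) →L[ℝ] ℝ) (e : Fin 2 →₀ ℕ)
        (T T' a u : Fin m → (Fin 2 →₀ ℕ)) (cf cg : Fin m → (Fin 2 →₀ ℕ) → ℂ),
      (∀ b c : Fin m → (Fin 2 →₀ ℕ), (∀ j, b j ∈ S j) → (∀ j, c j ∈ S j) → ∑ j, b j = ∑ j, c j → b = c) →
      (∀ b c : Fin m → (Fin 2 →₀ ℕ), (∀ j, b j ∈ S' j) → (∀ j, c j ∈ S' j) → ∑ j, b j = ∑ j, c j → b = c) →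
      (∀ j, T j ∈ S j) → (∀ j, ∀ x ∈ S j, lexKey lc x ≤ lexKey lc (T j)) →
      (∀ j, T' j ∈ S' j) → (∀ j, ∀ x ∈ S' j, lexKey lc x ≤ lexKey lc (T' j)) →
      (∀ j, a j ∈ S j) → ∑ j, a j = e → (∀ j, u j ∈ S' j) → ∑ j, u j = e →
      ∑ j, T j = ∑ j, T' j → lexKey lc e < lexKey lc (∑ j, T j) →
      (∀ b : Fin m → (Fin 2 →₀ ℕ), (∀ j, b j ∈ S j) → ∑ j, b j ≠ e → lc (emb e) ≤ lc (emb (∑ j, b j)) →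
        ∃ c : Fin m → (Fin 2 →₀ ℕ), (∀ j, c j ∈ S' j) ∧ ∑ j, c j = ∑ j, b j) →
      (∀ c : Fin m → (Fin 2 →₀ ℕ), (∀ j, c j ∈ S' j) → ∑ j, c j ≠ e → lc (emb e) ≤ lc (emb (∑ j, c j)) →
        ∃ b : Fin m → (Fin 2 →₀ ℕ), (∀ j, b j ∈ S j) ∧ ∑ j, b j = ∑ j, c j) →
      4 ≤ (Finset.univ.filter fun i => a i ≠ T i).card → 4 ≤ (Finset.univ.filter fun i => u i ≠ T' i).card →
      (∀ j, ∀ x ∈ S j, cf j x ≠ 0) → (∀ j, ∀ x ∈ S' j, cg j x ≠ 0) →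
      (∀ b c : Fin m → (Fin 2 →₀ ℕ), (∀ j, b j ∈ S j) → (∀ j, c j ∈ S' j) → ∑ j, b j = ∑ j, c j →
        ∑ j, b j ≠ e → lc (emb e) ≤ lc (emb (∑ j, b j)) → ∏ j, cf j (b j) + ∏ j, cg j (c j) = 0) →
      ∏ j, cf j (a j) + ∏ j, cg j (u j) ≠ 0 →
      ∃ (w : Fin m → (Fin 2 →₀ ℕ)) (p : Fin m) (y : Fin 2 →₀ ℕ), (∀ i, w i ∈ S' i) ∧
        (Finset.univ.filter fun i => w i ≠ T' i).card ≤ 2 ∧ y ∈ S' p ∧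
        emb e = emb (∑ i, w i) - (emb (T' p) - emb y)) :
    {p : Fin 2 → ℝ | p ∈ Set.extremePoints ℝ (convexHull ℝ
          (emb '' ((∏ j, f j + ∏ j, g j).support : Set (Fin 2 →₀ ℕ)))) ∧
        ∃ l : (Fin 2 → ℝ) →ₗ[ℝ] ℝ,
          (∀ q ∈ emb '' ((∏ j, f j + ∏ j, g j).support : Set (Fin 2 →₀ ℕ)), q ≠ p → l q < l p) ∧
          ∃ q ∈ emb '' ((∏ j, f j).support : Set (Fin 2 →₀ ℕ)) ∪ emb '' ((∏ j, g j).support : Set (Fin 2 →₀ ℕ)),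
            l p < l q}.ncard ≤ (m * t + 2) ^ 8 := by
  have hinjf : ∀ a b : Fin m → (Fin 2 →₀ ℕ), (∀ j, a j ∈ (f j).support) → (∀ j, b j ∈ (f j).support) →
      ∑ j, a j = ∑ j, b j → a = b := fun a b ha hb => hinjA a b (fun j => hf j (ha j)) (fun j => hf j (hb j))
  have hinjg : ∀ a b : Fin m → (Fin 2 →₀ ℕ), (∀ j, a j ∈ (g j).support) → (∀ j, b j ∈ (g j).support) →
      ∑ j, a j = ∑ j, b j → a = b := fun a b ha hb => hinjB a b (fun j => hg j (ha j)) (fun j => hg j (hb j))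
  exact crossCancel_of_shallowNeighbour m t A B f g hA hB hf hg hinjA hinjB
    (shallowNeighbour_of_cores f g hinjf hinjg hOut hBoth) (shallowNeighbour_of_cores g f hinjg hinjf hOut hBoth)

/-- **The BOTH kernel from deep–deep cancellation (Conjecture Q4′ in weight form).**  If letter weights that cancel at every light
common point below a common vertex whose two words both demote ≥ 4 letters also cancel AT the vertex (`hCancel` — the integral form
of Q4′ of `Cruxes/TwoProducts/memo-IX-robust.md` §2, unrefuted in ≈ 6·10⁴ deep–deep pairs incl. mixed-radix windows, `memo-IX-g4.md` §2),
then the BOTH kernel of `shallowNeighbour_of_cores` holds vacuously.  So the per-vertex content of the `k = 2` layer is the OUT kernel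
plus `hCancel`. [ours] -/
theorem bothKernel_of_cancel
    (hCancel : ∀ (S S' : Fin m → Finset (Fin 2 →₀ ℕ)) (lc : (Fin 2 → ℝ) →L[ℝ] ℝ) (e : Fin 2 →₀ ℕ)
        (T T' a u : Fin m → (Fin 2 →₀ ℕ)) (cf cg : Fin m → (Fin 2 →₀ ℕ) → ℂ),
      (∀ b c : Fin m → (Fin 2 →₀ ℕ), (∀ j, b j ∈ S j) → (∀ j, c j ∈ S j) → ∑ j, b j = ∑ j, c j → b = c) →
      (∀ b c : Fin m → (Fin 2 →₀ ℕ), (∀ j, b j ∈ S' j) → (∀ j, c j ∈ S' j) → ∑ j, b j = ∑ j, c j → b = c) →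
      (∀ j, T j ∈ S j) → (∀ j, ∀ x ∈ S j, lexKey lc x ≤ lexKey lc (T j)) →
      (∀ j, T' j ∈ S' j) → (∀ j, ∀ x ∈ S' j, lexKey lc x ≤ lexKey lc (T' j)) →
      (∀ j, a j ∈ S j) → ∑ j, a j = e → (∀ j, u j ∈ S' j) → ∑ j, u j = e →
      ∑ j, T j = ∑ j, T' j → lexKey lc e < lexKey lc (∑ j, T j) →
      (∀ b : Fin m → (Fin 2 →₀ ℕ), (∀ j, b j ∈ S j) → ∑ j, b j ≠ e → lc (emb e) ≤ lc (emb (∑ j, b j)) →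
        ∃ c : Fin m → (Fin 2 →₀ ℕ), (∀ j, c j ∈ S' j) ∧ ∑ j, c j = ∑ j, b j) →
      (∀ c : Fin m → (Fin 2 →₀ ℕ), (∀ j, c j ∈ S' j) → ∑ j, c j ≠ e → lc (emb e) ≤ lc (emb (∑ j, c j)) →
        ∃ b : Fin m → (Fin 2 →₀ ℕ), (∀ j, b j ∈ S j) ∧ ∑ j, b j = ∑ j, c j) →
      4 ≤ (Finset.univ.filter fun i => a i ≠ T i).card → 4 ≤ (Finset.univ.filter fun i => u i ≠ T' i).card →
      (∀ j, ∀ x ∈ S j, cf j x ≠ 0) → (∀ j, ∀ x ∈ S' j, cg j x ≠ 0) →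
      (∀ b c : Fin m → (Fin 2 →₀ ℕ), (∀ j, b j ∈ S j) → (∀ j, c j ∈ S' j) → ∑ j, b j = ∑ j, c j →
        ∑ j, b j ≠ e → lc (emb e) ≤ lc (emb (∑ j, b j)) → ∏ j, cf j (b j) + ∏ j, cg j (c j) = 0) →
      ∏ j, cf j (a j) + ∏ j, cg j (u j) = 0) :
    ∀ (S S' : Fin m → Finset (Fin 2 →₀ ℕ)) (lc : (Fin 2 → ℝ) →L[ℝ] ℝ) (e : Fin 2 →₀ ℕ)
        (T T' a u : Fin m → (Fin 2 →₀ ℕ)) (cf cg : Fin m → (Fin 2 →₀ ℕ) → ℂ),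
      (∀ b c : Fin m → (Fin 2 →₀ ℕ), (∀ j, b j ∈ S j) → (∀ j, c j ∈ S j) → ∑ j, b j = ∑ j, c j → b = c) →
      (∀ b c : Fin m → (Fin 2 →₀ ℕ), (∀ j, b j ∈ S' j) → (∀ j, c j ∈ S' j) → ∑ j, b j = ∑ j, c j → b = c) →
      (∀ j, T j ∈ S j) → (∀ j, ∀ x ∈ S j, lexKey lc x ≤ lexKey lc (T j)) →
      (∀ j, T' j ∈ S' j) → (∀ j, ∀ x ∈ S' j, lexKey lc x ≤ lexKey lc (T' j)) →
      (∀ j, a j ∈ S j) → ∑ j, a j = e → (∀ j, u j ∈ S' j) → ∑ j, u j = e →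
      ∑ j, T j = ∑ j, T' j → lexKey lc e < lexKey lc (∑ j, T j) →
      (∀ b : Fin m → (Fin 2 →₀ ℕ), (∀ j, b j ∈ S j) → ∑ j, b j ≠ e → lc (emb e) ≤ lc (emb (∑ j, b j)) →
        ∃ c : Fin m → (Fin 2 →₀ ℕ), (∀ j, c j ∈ S' j) ∧ ∑ j, c j = ∑ j, b j) →
      (∀ c : Fin m → (Fin 2 →₀ ℕ), (∀ j, c j ∈ S' j) → ∑ j, c j ≠ e → lc (emb e) ≤ lc (emb (∑ j, c j)) →
        ∃ b : Fin m → (Fin 2 →₀ ℕ), (∀ j, b j ∈ S j) ∧ ∑ j, b j = ∑ j, c j) →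
      4 ≤ (Finset.univ.filter fun i => a i ≠ T i).card → 4 ≤ (Finset.univ.filter fun i => u i ≠ T' i).card →
      (∀ j, ∀ x ∈ S j, cf j x ≠ 0) → (∀ j, ∀ x ∈ S' j, cg j x ≠ 0) →
      (∀ b c : Fin m → (Fin 2 →₀ ℕ), (∀ j, b j ∈ S j) → (∀ j, c j ∈ S' j) → ∑ j, b j = ∑ j, c j →
        ∑ j, b j ≠ e → lc (emb e) ≤ lc (emb (∑ j, b j)) → ∏ j, cf j (b j) + ∏ j, cg j (c j) = 0) →
      ∏ j, cf j (a j) + ∏ j, cg j (u j) ≠ 0 →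
      ∃ (w : Fin m → (Fin 2 →₀ ℕ)) (p : Fin m) (y : Fin 2 →₀ ℕ), (∀ i, w i ∈ S' i) ∧
        (Finset.univ.filter fun i => w i ≠ T' i).card ≤ 2 ∧ y ∈ S' p ∧
        emb e = emb (∑ i, w i) - (emb (T' p) - emb y) := by
  intro S S' lc e T T' a u cf cg hS hS' hT hTmax hT' hTmax' ha hae hu hue htop hTe hwin hwin' h4 hu4 hcf hcg hcan hne
  exact absurd (hCancel S S' lc e T T' a u cf cg hS hS' hT hTmax hT' hTmax' ha hae hu hue htop hTe hwin hwin' h4 hu4 hcf hcg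
    hcan) hne

/-- **The `k = 2` count from the OUT kernel and deep–deep cancellation.**  `crossCancel_of_cores` with the BOTH kernel supplied by
`bothKernel_of_cancel`: for every pair of dissociated frames the cross-cancelling vertices number `≤ (m t + 2)^8`, given the
window-factorization statement `hOut` and the cancellation statement `hCancel` (Q4′). [ours] -/
theorem crossCancel_of_out_of_cancel (m t : ℕ) (A B : Fin m → Finset (Fin 2 →₀ ℕ))
    (f g : Fin m → MvPolynomial (Fin 2) ℂ)
    (hA : ∀ j, (A j).card ≤ t) (hB : ∀ j, (B j).card ≤ t)
    (hf : ∀ j, (f j).support ⊆ A j) (hg : ∀ j, (g j).support ⊆ B j)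
    (hinjA : ∀ a b : Fin m → (Fin 2 →₀ ℕ), (∀ j, a j ∈ A j) → (∀ j, b j ∈ A j) → ∑ j, a j = ∑ j, b j → a = b)
    (hinjB : ∀ a b : Fin m → (Fin 2 →₀ ℕ), (∀ j, a j ∈ B j) → (∀ j, b j ∈ B j) → ∑ j, a j = ∑ j, b j → a = b)
    (hOut : ∀ (S S' : Fin m → Finset (Fin 2 →₀ ℕ)) (lc : (Fin 2 → ℝ) →L[ℝ] ℝ) (e : Fin 2 →₀ ℕ)
        (T T' a : Fin m → (Fin 2 →₀ ℕ)),
      (∀ b c : Fin m → (Fin 2 →₀ ℕ), (∀ j, b j ∈ S j) → (∀ j, c j ∈ S j) → ∑ j, b j = ∑ j, c j → b = c) →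
      (∀ b c : Fin m → (Fin 2 →₀ ℕ), (∀ j, b j ∈ S' j) → (∀ j, c j ∈ S' j) → ∑ j, b j = ∑ j, c j → b = c) →
      (∀ j, T j ∈ S j) → (∀ j, ∀ x ∈ S j, lexKey lc x ≤ lexKey lc (T j)) →
      (∀ j, T' j ∈ S' j) → (∀ j, ∀ x ∈ S' j, lexKey lc x ≤ lexKey lc (T' j)) →
      (∀ j, a j ∈ S j) → ∑ j, a j = e → ∑ j, T j = ∑ j, T' j → lexKey lc e < lexKey lc (∑ j, T j) →
      (∀ b : Fin m → (Fin 2 →₀ ℕ), (∀ j, b j ∈ S j) → ∑ j, b j ≠ e → lc (emb e) ≤ lc (emb (∑ j, b j)) →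
        ∃ c : Fin m → (Fin 2 →₀ ℕ), (∀ j, c j ∈ S' j) ∧ ∑ j, c j = ∑ j, b j) →
      (∀ c : Fin m → (Fin 2 →₀ ℕ), (∀ j, c j ∈ S' j) → ∑ j, c j ≠ e → lc (emb e) ≤ lc (emb (∑ j, c j)) →
        ∃ b : Fin m → (Fin 2 →₀ ℕ), (∀ j, b j ∈ S j) ∧ ∑ j, b j = ∑ j, c j) →
      (∀ c : Fin m → (Fin 2 →₀ ℕ), (∀ j, c j ∈ S' j) → ∑ j, c j ≠ e) →
      4 ≤ (Finset.univ.filter fun i => a i ≠ T i).card →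
      ∃ (w : Fin m → (Fin 2 →₀ ℕ)) (p : Fin m) (y : Fin 2 →₀ ℕ), (∀ i, w i ∈ S' i) ∧
        (Finset.univ.filter fun i => w i ≠ T' i).card ≤ 2 ∧ y ∈ S' p ∧
        emb e = emb (∑ i, w i) - (emb (T' p) - emb y))
    (hCancel : ∀ (S S' : Fin m → Finset (Fin 2 →₀ ℕ)) (lc : (Fin 2 → ℝ) →L[ℝ] ℝ) (e : Fin 2 →₀ ℕ)
        (T T' a u : Fin m → (Fin 2 →₀ ℕ)) (cf cg : Fin m → (Fin 2 →₀ ℕ) → ℂ),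
      (∀ b c : Fin m → (Fin 2 →₀ ℕ), (∀ j, b j ∈ S j) → (∀ j, c j ∈ S j) → ∑ j, b j = ∑ j, c j → b = c) →
      (∀ b c : Fin m → (Fin 2 →₀ ℕ), (∀ j, b j ∈ S' j) → (∀ j, c j ∈ S' j) → ∑ j, b j = ∑ j, c j → b = c) →
      (∀ j, T j ∈ S j) → (∀ j, ∀ x ∈ S j, lexKey lc x ≤ lexKey lc (T j)) →
      (∀ j, T' j ∈ S' j) → (∀ j, ∀ x ∈ S' j, lexKey lc x ≤ lexKey lc (T' j)) →
      (∀ j, a j ∈ S j) → ∑ j, a j = e → (∀ j, u j ∈ S' j) → ∑ j, u j = e →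
      ∑ j, T j = ∑ j, T' j → lexKey lc e < lexKey lc (∑ j, T j) →
      (∀ b : Fin m → (Fin 2 →₀ ℕ), (∀ j, b j ∈ S j) → ∑ j, b j ≠ e → lc (emb e) ≤ lc (emb (∑ j, b j)) →
        ∃ c : Fin m → (Fin 2 →₀ ℕ), (∀ j, c j ∈ S' j) ∧ ∑ j, c j = ∑ j, b j) →
      (∀ c : Fin m → (Fin 2 →₀ ℕ), (∀ j, c j ∈ S' j) → ∑ j, c j ≠ e → lc (emb e) ≤ lc (emb (∑ j, c j)) →
        ∃ b : Fin m → (Fin 2 →₀ ℕ), (∀ j, b j ∈ S j) ∧ ∑ j, b j = ∑ j, c j) →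
      4 ≤ (Finset.univ.filter fun i => a i ≠ T i).card → 4 ≤ (Finset.univ.filter fun i => u i ≠ T' i).card →
      (∀ j, ∀ x ∈ S j, cf j x ≠ 0) → (∀ j, ∀ x ∈ S' j, cg j x ≠ 0) →
      (∀ b c : Fin m → (Fin 2 →₀ ℕ), (∀ j, b j ∈ S j) → (∀ j, c j ∈ S' j) → ∑ j, b j = ∑ j, c j →
        ∑ j, b j ≠ e → lc (emb e) ≤ lc (emb (∑ j, b j)) → ∏ j, cf j (b j) + ∏ j, cg j (c j) = 0) →
      ∏ j, cf j (a j) + ∏ j, cg j (u j) = 0) :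
    {p : Fin 2 → ℝ | p ∈ Set.extremePoints ℝ (convexHull ℝ
          (emb '' ((∏ j, f j + ∏ j, g j).support : Set (Fin 2 →₀ ℕ)))) ∧
        ∃ l : (Fin 2 → ℝ) →ₗ[ℝ] ℝ,
          (∀ q ∈ emb '' ((∏ j, f j + ∏ j, g j).support : Set (Fin 2 →₀ ℕ)), q ≠ p → l q < l p) ∧
          ∃ q ∈ emb '' ((∏ j, f j).support : Set (Fin 2 →₀ ℕ)) ∪ emb '' ((∏ j, g j).support : Set (Fin 2 →₀ ℕ)),
            l p < l q}.ncard ≤ (m * t + 2) ^ 8 :=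
  crossCancel_of_cores m t A B f g hA hB hf hg hinjA hinjB hOut (bothKernel_of_cancel hCancel)

end Core

end

end Summit.ValiantsHypothesis.ValiantsHypothesis.Theorems.NewtonFramesTwoProducts.FrameRungTwoTrinomial
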